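import Summits.BirchSwinnertonDyer.BirchSwinnertonDyer.Theses.ResidualThetaTransportAtTwo
import Summits.BirchSwinnertonDyer.BirchSwinnertonDyer.Theorems.ResidualThetaTransportAtTwoResidualSignedLambdaLowerCMAtTwoAwayCharacterGlue
import Summits.BirchSwinnertonDyer.BirchSwinnertonDyer.Theorems.ResidualThetaTransportAtTwoResidualSignedLambdaLowerCMAtTwoAwayPinsSmul
import Summits.BirchSwinnertonDyer.BirchSwinnertonDyer.Theorems.ResidualThetaTransportAtTwoResidualSignedLambdaLowerCMAtTwoDeepHalfAwayTwoTowerPow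
import Summits.BirchSwinnertonDyer.BirchSwinnertonDyer.Theorems.ResidualThetaTransportAtTwoResidualSignedLambdaLowerCMAtTwoStubDeepHalfAtTwoStrictPins
import Summits.BirchSwinnertonDyer.BirchSwinnertonDyer.Theorems.ResidualThetaTransportAtTwoResidualSignedLambdaLowerCMAtTwoSupplyOfPackages
import Summits.BirchSwinnertonDyer.BirchSwinnertonDyer.Theorems.ResidualThetaTransportAtTwoResidualSignedLambdaLowerCMAtTwoAtTwoPackage
import Summits.BirchSwinnertonDyer.BirchSwinnertonDyer.Theorems.ResidualThetaTransportAtTwoResidualSignedLambdaLowerCMAtTwoSupplyCountPins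
import Summits.BirchSwinnertonDyer.BirchSwinnertonDyer.Theorems.ResidualThetaTransportAtTwoResidualSignedLambdaLowerCMAtTwoSupplyCountSigma
import Summits.BirchSwinnertonDyer.BirchSwinnertonDyer.Theorems.ResidualThetaTransportAtTwoResidualSignedLambdaLowerCMAtTwoSupplyZeta
import Summits.BirchSwinnertonDyer.BirchSwinnertonDyer.Theorems.ResidualThetaTransportAtTwoResidualSignedLambdaLowerCMAtTwoSupplyOrthPins
import Summits.BirchSwinnertonDyer.BirchSwinnertonDyer.Theorems.ResidualThetaTransportAtTwoResidualSignedLambdaLowerCMAtTwoSupplyCompatPins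
import Summits.BirchSwinnertonDyer.BirchSwinnertonDyer.Theorems.ResidualThetaTransportAtTwoResidualSignedLambdaLowerCMAtTwoDlocPadicModule
import Literature.NumberTheory.EllipticCurves.Kato2004.IwasawaCohomologyCoeffNewform
import Literature.NumberTheory.EllipticCurves.BSDConductorProofs
import Literature.NumberTheory.EllipticCurves.CMNewformGamma0LevelSquarefull
import HarnessLib

/-!
# The GLUE STUB `stub_onePairSupply` of line «onepair», BY NAME (LVsq → S1⊕ → EH → S4₂ → S4₀ → S2 → SUPPLY₂), with the Away package T2 (b)

Route `ResidualThetaTransportAtTwo` (RTT), crux RSL_g `ResidualSignedLambdaLowerCMAtTwo` (stmt-BirchSwinnertonDyer-22608), line «onepair» (v3d,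
`Cruxes/ResidualSignedLambdaLowerCMAtTwo/Lines/onepair.lean`), `Cruxes/…/ASSEMBLY-SPEC-g19.md`; LEAD `prover-bsd-wall-rtt-p2` g19 (`--supports 22608
--as helper`; the skeleton's `stub_onePairSupply` becomes `OnePair.stub_onePairSupply` in v3e). THEOREMS ONLY (no definition, no named fact, no instance,
no `sorry`). BSD is not proved by any of this; RSL_g stays OPEN until the skeleton's last two `sorry`s (S3 = KZ_g PRINT HOLD stmt-…-24105, LVsq PRINT)
are discharged.

§1 — T2 (b), THE S₀-SIDE PIN BUNDLE EXISTS (GLUE-SPEC-g18 §1 T2). The split texts S1⊕ / EH / S4₂ / S4₀ quantify over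
`[∀ w : ↥S₀, Module ℤ_[2] (Dloc S κ ρ w)] (πₐ : AwayPins S κ ρ S₀ W γ n Θ hΘ I Sg π)`; under `letI := fun w ↦ dlocModule S κ ρ w` (p702669) ONE such `πₐ`
exists: `locdS x w c` := THE glued S₀-side value character of `x` at `(w, c.out)` (`ThetaTransport.exists_awayCharacter`, `…AwayCharacterGlue`: direct
limit over the `(n, k)`-system; n-compatibility p696153; k-compatibility = the mixed projection formula of tp2-p2x's `…DeepHalfAwayTwoTowerPow`
`AwayTowerPow.layerPairingH1Of_pow_incl_val_smul` fed with w2's `OnePairPins.ePk_tower_of_zeta_sq hζ2` and tp2-p2x's `cofreeTorsionIncl` / `muLocalIncl`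
— `mixedProjection_of_pins`), additive in `x` by `awayCharacter_unique` + `awayLevelChar_add`, value-pinned by construction, `ℤ₂`-compatible by w2's
`OnePairPins.locdS_smul_of_valuePin` (`…AwayPinsSmul`).
* `OnePair.mixedProjection_of_pins`, `OnePair.exists_awayPins : Nonempty (AwayPins S κ ρ S₀ W γ n Θ hΘ I Sg π)`.

§2 — THE GLUE STUB BY NAME. `OnePair.stub_onePairSupply` has EXACTLY the registered type of the skeleton stub (six hypotheses = the texts of LVsq / S1⊕ /
EH / S4₂ / S4₀ / S2, conclusion = the SUPPLY₂ text). PROOF (ASSEMBLY-SPEC-g19): introduce the SUPPLY₂ binders; bundle the pins `π : OnePairPins …` (a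
structure literal of the binders, so every `π.field` is the binder definitionally); S2 at the pins (`pair₂`, compatibility, VAL, KER); T1 =
`AtTwoPackage.exists_atTwoPins_perfect` (p706129); `dlocModule` + T2 = §1; S1⊕ at `(π, πₐ)` transported to the supply exponent `Σ_g(S₀)` by
`mul_sigma_supply_le_of_away` (w2, LVsq); the counts C7 (`OnePairPins.finite_and_count_span_locd_pins`, w2) and C6 (`OnePairPins.supplyZeta_of_pins`, w2);
the integrands C4 (`OnePairPins.c₂_add_sum_locAway_eq_zero_of_mem_Sel₀`, w2) and C5 (`OnePairPins.sum_smul_locAway`, w2); then C8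
`OnePair.onePairSupply_of_packages` with EH / S4₂ / S4₀ applied at `(π, hζ2, π₂, πₐ)`.

References: [Kato2004Asterisque] §12–§13 (pp. 220–229), §17.13; [PerrinRiou1994Invent] §3.6.1; [Kobayashi2003] Thm. 7.3 ((7.17)–(7.21));
[MilneADT2006] Ch. I Thm. 4.10; [GreenbergVatsal2000] §2 Prop. 2.4; [SerreGaloisCohomology1997] I §2.2 Prop. 8.
-/

set_option autoImplicit false
-- the Theorems namespace of this sub repeats the summit name by design (D-0017 nested layout)
set_option linter.dupNamespace false

noncomputable section

open scoped Classical TensorProduct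

namespace Summit.BirchSwinnertonDyer.BirchSwinnertonDyer.Theorems.OnePair

open Summit.BirchSwinnertonDyer.BirchSwinnertonDyer.Theorems Summit.BirchSwinnertonDyer.BirchSwinnertonDyer.Theorems.ThetaTransport
open Literature.NumberTheory.EllipticCurves Literature.NumberTheory.EllipticCurves.GreenbergSelmer Literature.NumberTheory.Automorphic
open Literature.NumberTheory.GaloisRepresentations NumberField IsDedekindDomain Field

section AwayPackage

open CategoryTheory Topology Literature.NumberTheory.EllipticCurves.CyclotomicLayer Literature.NumberTheory.EllipticCurves.Kato2004

variable {S : Set (PadicAlgCl 2)} {W : WeierstrassCurve ℚ} [W.IsElliptic] {κ : ZpExtension ℚ 2} {γ : absoluteGaloisGroup ℚ}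
  {S₀ : Finset (HeightOneSpectrum (𝓞 ℚ))} {n : ℕ} {ρ : FramedGaloisRep ℚ ↥(padicCoeffIntegers S) 2}
  {Θ : ∀ v : HeightOneSpectrum (𝓞 ℚ), ((2 : ℕ) : 𝓞 ℚ) ∈ v.asIdeal → (Cofree ρ ↥(padicCoeffField S) ≃+ (Fin n → ↥(W.geomPrimaryTorsion 2)))}
  {hΘ : ∀ v hv (δ : absoluteGaloisGroup (v.adicCompletion ℚ)) m i,
    Θ v hv (resGalOfEmb (closureEmb (K := ℚ) (v.adicCompletion ℚ)) δ • m) i = resGalOfEmb (closureEmb (K := ℚ) (v.adicCompletion ℚ)) δ • Θ v hv m i}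
  {I : Kato2004.IwasawaH1DataCoeff (FramedGaloisRep.toGaloisRep ρ) 2 κ γ}
  {Sg : AddSubgroup (subgroupH1 κ.kerSubgroup (Cofree ρ ↥(padicCoeffField S)))} [Module ↥(padicCoeffIntegers S) ↥Sg]
  (π : OnePairPins S W κ γ S₀ n ρ Θ hΘ I Sg)

/-! ## §1 The Away package T2 (b) -/

/-! ### The mixed projection formula for the pins' tower -/

/-- **(K) for the pins.** `(⟨[2]_* b, y⟩_{m,2^k,w}).val • 2^{-k} = (⟨b, ι_* y⟩_{m,2^{k+1},w}).val • 2^{-(k+1)}` for the self-dual tower `π.ePk` with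
compatible roots `ζ_{k+1}² = ζ_k` — tp2-p2x's `AwayTowerPow.layerPairingH1Of_pow_incl_val_smul` with `htower := π.ePk_tower_of_zeta_sq hζ2`, `ι :=
cofreeTorsionIncl`, `γ := muLocalIncl`, read in the `2^{-k} ∈ ℚ/ℤ` currency of `AwayPins.hlocdS`. [cite: PerrinRiou1994Invent, §3.6.1]
[cite: Kato2004Asterisque, §13.8 (pp. 228–229)] [cite: SerreLocalFields1979, XIII §3] -/
theorem mixedProjection_of_pins (hζ2 : ∀ k : ℕ, π.ζ (k + 1) ^ 2 = π.ζ k) (w : HeightOneSpectrum (𝓞 ℚ)) (m k : ℕ)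
    (b : continuousCohomology 1 (subgroupRep (localRepOf (cofreeTorsionGaloisModule S ρ ((2 ^ (k + 1) : ℕ) : ℤ)) w) (layerGroup κ w m)))
    (y : Dlev S κ ρ w m k) :
    (layerPairingH1Of (cofreeTorsionGaloisModule S ρ ((2 ^ k : ℕ) : ℤ)) (2 ^ k) (π.ePk k) (π.hμPk k) (π.hadd₁Pk k) (π.hadd₂Pk k) (π.hgalPk k) κ w m
        (cohomologyMap (subgroupRepMap (Y := localRepOf (cofreeTorsionGaloisModule S ρ ((2 ^ k : ℕ) : ℤ)) w)
          (cofreeTorsionLocalPow S ρ k w) (layerGroup κ w m)) 1 b) y).val • ((((2 : ℚ) ^ k)⁻¹ : ℚ) : AddCircle (1 : ℚ)) =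
      (layerPairingH1Of (cofreeTorsionGaloisModule S ρ ((2 ^ (k + 1) : ℕ) : ℤ)) (2 ^ (k + 1)) (π.ePk (k + 1)) (π.hμPk (k + 1))
          (π.hadd₁Pk (k + 1)) (π.hadd₂Pk (k + 1)) (π.hgalPk (k + 1)) κ w m b
        (cohomologyMap (subgroupRepMap (Y := localRepOf (cofreeTorsionGaloisModule S ρ ((2 ^ (k + 1) : ℕ) : ℤ)) w)
          (cofreeTorsionLocalIncl S ρ k w) (layerGroup κ w m)) 1 y)).val • ((((2 : ℚ) ^ (k + 1))⁻¹ : ℚ) : AddCircle (1 : ℚ)) := by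
  haveI : CompactSpace (absoluteGaloisGroup (w.adicCompletion ℚ)) := absoluteGaloisGroup_compactSpace _
  have h := AwayTowerPow.layerPairingH1Of_pow_incl_val_smul S ρ π.ePk π.hμPk π.hadd₁Pk π.hadd₂Pk π.hgalPk (π.ePk_tower_of_zeta_sq hζ2) k
    (cofreeTorsionIncl S ρ k) (coe_cofreeTorsionIncl_apply S ρ k) w (muLocalIncl k w) (fun x ↦ muVal_muLocalIncl k w x) κ m b y
  -- `((2 : ℕ) : ℚ) = (2 : ℚ)` (the tower lemma is stated for a general prime `p`, read at `p = 2`)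
  rw [Nat.cast_ofNat] at h
  exact h

/-! ### Existence of the S₀-side pin bundle -/

/-- **`AwayPins π` EXISTS** (GLUE package T2 (b)) for every binder family of `ℤ₂`-structures on the `D_w` equal to the functorial action (`hD`;
`letI := fun w ↦ dlocModule S κ ρ w` with `dlocModule_smul_def`), `κ` cyclotomic, `S₀` odd, `ζ_{k+1}² = ζ_k`: `locdS x w c` is the glued value
character of `x` at `(w, c.out)` (`ThetaTransport.exists_awayCharacter`), additive in `x` by uniqueness, value-pinned by construction, and
`ℤ₂`-compatible by `OnePairPins.locdS_smul_of_valuePin`. [cite: Kato2004Asterisque, §13.8 (pp. 228–229)] [cite: PerrinRiou1994Invent, §3.6.1]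
[cite: GreenbergVatsal2000, §2 Prop. 2.4] [cite: SerreGaloisCohomology1997, I §2.2 Prop. 8] -/
theorem exists_awayPins (hκ : κ.IsCyclotomic) (hS₀ : ∀ w ∈ S₀, ((2 : ℕ) : 𝓞 ℚ) ∉ w.asIdeal) (hζ2 : ∀ k : ℕ, π.ζ (k + 1) ^ 2 = π.ζ k)
    [∀ w : ↥S₀, Module ℤ_[2] (Dloc S κ ρ (w : HeightOneSpectrum (𝓞 ℚ)))]
    (hD : ∀ (w : ↥S₀) (a : ℤ_[2]) (y : Dloc S κ ρ (w : HeightOneSpectrum (𝓞 ℚ))), a • y = DlocSMul S κ ρ w (padicIntToCoeffIntegers S a) y) :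
    Nonempty (AwayPins S κ ρ S₀ W γ n Θ hΘ I Sg π) := by
  -- the glued characters, one for each `(x, w, c)`
  have H := fun (x : I.H) (w : ↥S₀) (c : Cosets κ (w : HeightOneSpectrum (𝓞 ℚ))) ↦
    exists_awayCharacter S ρ π.ePk π.hμPk π.hadd₁Pk π.hadd₂Pk π.hgalPk κ hκ (w : HeightOneSpectrum (𝓞 ℚ)) (hS₀ w w.2) I
      (fun m _ k b y ↦ mixedProjection_of_pins π hζ2 (w : HeightOneSpectrum (𝓞 ℚ)) m k b y) x c.out
  choose Χ hΧ using H
  -- the prescribed level values are additive in `x`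
  have hadd : ∀ (x x' : I.H) (w : ↥S₀) (c : Cosets κ (w : HeightOneSpectrum (𝓞 ℚ))), Χ (x + x') w c = Χ x w c + Χ x' w c := by
    intro x x' w c
    refine awayCharacter_unique S ρ π.ePk π.hμPk π.hadd₁Pk π.hadd₂Pk π.hgalPk κ (w : HeightOneSpectrum (𝓞 ℚ)) I (x + x') c.out
      (hΧ (x + x') w c) fun m hm k y ↦ ?_
    rw [awayLevelChar_add, ← hΧ x w c m hm k y, ← hΧ x' w c m hm k y]
    exact AddMonoidHom.add_apply _ _ _
  let locdS : I.H →+ PAway S κ ρ S₀ := AddMonoidHom.mk' (fun x w c ↦ Χ x w c) fun x x' ↦ funext fun w ↦ funext fun c ↦ hadd x x' w c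
  have hlocdS : ∀ (w : ↥S₀) (c : Cosets κ (w : HeightOneSpectrum (𝓞 ℚ))) (m : ℕ), nfl (w : HeightOneSpectrum (𝓞 ℚ)) ≤ m →
      ∀ (k : ℕ) (x : I.H) (y : Dlev S κ ρ w m k),
      locdS x w c (jAway S κ ρ w m k y) =
        (layerPairingOf (cofreeTorsionGaloisModule S ρ ((2 ^ k : ℕ) : ℤ)) (2 ^ k) (π.ePk k) (π.hμPk k) (π.hadd₁Pk k) (π.hadd₂Pk k) (π.hgalPk k) κ w m
          (reduceH1CofreePkTorsion S ρ k (κ.layerSubgroup m)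
            (conjMap (FramedGaloisRep.toGaloisRep ρ).toTopRep (κ.layerSubgroup m) c.out 1 (I.proj m x))) y).val •
          ((((2 : ℚ) ^ k)⁻¹ : ℚ) : AddCircle (1 : ℚ)) :=
    fun w c m hm k x y ↦ (hΧ x w c m hm k y).trans
      (awayLevelChar_apply S ρ π.ePk π.hμPk π.hadd₁Pk π.hadd₂Pk π.hgalPk κ (w : HeightOneSpectrum (𝓞 ℚ)) I x c.out m k y)
  exact ⟨{ hD := hD
           locdS := locdS
           hlocdS_smul := fun a x ↦ OnePairPins.locdS_smul_of_valuePin π hD locdS hlocdS a x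
           hlocdS := hlocdS }⟩

end AwayPackage

/-! ## §2 The glue stub by name -/

-- ~80 binders per text, six registered texts as hypotheses, one 17 000-character conclusion: every application of a text re-unifies all
-- its binder types, measured ≈ 200 s of elaboration on the farm (scratch run with no cap, rc 0) — far beyond the default budget
set_option maxHeartbeats 100000000 in
/-- **`stub_onePairSupply` (the GLUE of line «onepair») BY NAME**: LVsq → S1⊕ → EH → S4₂ → S4₀ → S2 → SUPPLY₂, with exactly the registered type of the
skeleton stub; proof = ASSEMBLY-SPEC-g19 (pins bundled, T1/T2 packages, S2 at the pins, C4–C8). [cite: Kobayashi2003, Thm. 7.3 ((7.17)–(7.21))]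
[cite: MilneADT2006, Ch. I, Thm. 4.10] [cite: GreenbergVatsal2000, §2 Prop. 2.4] -/
theorem stub_onePairSupply :
    Literature.NumberTheory.EllipticCurves.ModularForms.cmNewform_gamma0_sq_dvd_level →
    (
    open Literature.NumberTheory.EllipticCurves GreenbergSelmer GreenbergVatsal2000 Kobayashi2003 ModularForms Rank1Residual Literature.NumberTheory.GaloisRepresentations Literature.NumberTheory.Automorphic IsDedekindDomain NumberField Field Rat.HeightOneSpectrum PowerSeries Summit.BirchSwinnertonDyer.BirchSwinnertonDyer.Theorems.OnePair in ∀ (W : WeierstrassCurve ℚ) [W.IsElliptic] [W.IsGloballyMinimal], GoodSS W 2 → W.frobeniusTrace 2 = 0 → W.Δ < 0 → ∀ (M : ℕ) [NeZero M] (g : CuspForm (CongruenceSubgroup.Gamma0 M) 2) (ι : coeffField g →+* PadicAlgCl 2), Odd M → IsNewform0 g → IsCMForm (liftToGamma1 M 2 g) → cuspCoeff g 2 = 0 → (∀ ℓ : ℕ, ℓ.Prime → ¬ ℓ ∣ 2 * M * W.conductorNorm ℤ → ‖embCoeff g ι ℓ - (W.frobeniusTrace ℓ : PadicAlgCl 2)‖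 < 1) → ∀ (κ : ZpExtension ℚ 2) (γ : absoluteGaloisGroup ℚ), κ.IsCyclotomic → κ.IsTopGenerator γ → IsCyclotomicVariable 2 γ → ∀ (S₀ : Finset (HeightOneSpectrum (RingOfIntegers ℚ))), (∀ v ∈ S₀, ((2 : ℕ) : RingOfIntegers ℚ) ∉ v.asIdeal) → (∀ v, ¬ W.HasGoodReductionAt v → v ∈ S₀) → (∀ v, natGenerator v ∣ M → v ∈ S₀) → ∀ (n : ℕ) (ρ : FramedGaloisRep ℚ (coeffO (Set.range ι)) 2) (Θ : ∀ v : HeightOneSpectrum (RingOfIntegers ℚ), ((2 : ℕ) : RingOfIntegers ℚ) ∈ v.asIdeal → (CofreeF (Set.range ι) ρ ≃+ (Fin n → ↥(W.geomPrimaryTorsion 2)))), (∀ v, ¬ natGenerator v ∣ 2 * M → ρ.IsUnramifiedAt v ∧ ∃ P : Polynomial (coeffO (Set.range ι)), P.map (padicCoeffIntegers (Set.range ι)).subtype = Polynomial.X ^ 2 - Polynomial.C (embCoeff g ι (natGenerator v)) * Polynomial.X + Polynomial.C ((natGenerator v : ℕ) : PadicAlgCl 2) ∧ ρ.HasFrobCharpolyAt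 v P) → ∀ (hΘ : ∀ v hv (δ : absoluteGaloisGroup (v.adicCompletion ℚ)) m i, Θ v hv (resGalOfEmb (closureEmb (K := ℚ) (v.adicCompletion ℚ)) δ • m) i = resGalOfEmb (closureEmb (K := ℚ) (v.adicCompletion ℚ)) δ • Θ v hv m i), ∀ (ϖ : (coeffO (Set.range ι))), Irreducible ϖ → ∀ (Sg : AddSubgroup (H1Γ (Set.range ι) κ ρ)) [Module (coeffO (Set.range ι)) ↥Sg], (∀ (a : (coeffO (Set.range ι))) (s : ↥Sg), ((a • s : ↥Sg) : H1Γ (Set.range ι) κ ρ) = scalarH1 κ.kerSubgroup (CofreeF (Set.range ι) ρ) a s) → (∀ y : H1Γ (Set.range ι) κ ρ, y ∈ Sg ↔ y ∈ plusSelmerSet (Set.range ι) W κ S₀ n ρ Θ) → (∀ (τ : absoluteGaloisGroup ℚ) (y : H1Γ (Set.range ι) κ ρ), y ∈ Sg → conjH1 κ.kerSubgroup (CofreeF (Set.range ι) ρ) τ y ∈ Sg) → (plusSelmerTorsionSet (Set.range ι) W κ S₀ n ρ Θ ϖ).Finite → ∀ (I : Kato2004.IwasawaH1DataCoeff (FramedGaloisRep.toGaloisRep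 ρ) 2 κ γ) [Module (coeffO (Set.range ι)) I.H] [IsScalarTower (coeffO (Set.range ι)) (IwasawaAlgebraO (Set.range ι)) I.H], (∀ (a : (coeffO (Set.range ι))) (x : I.H), a • x = (PowerSeries.C a : IwasawaAlgebraO (Set.range ι)) • x) → ∀ (π : OnePairPins (Set.range ι) W κ γ S₀ n ρ Θ hΘ I Sg), ∀ [∀ w : ↥S₀, Module ℤ_[2] (Dloc (Set.range ι) κ ρ (w : HeightOneSpectrum (RingOfIntegers ℚ)))] (πₐ : AwayPins (Set.range ι) κ ρ S₀ W γ n Θ hΘ I Sg π), Module.Finite ℚ_[2] (TensorProduct ℤ_[2] ℚ_[2] (PAway (Set.range ι) κ ρ S₀)) ∧ π.f * (∑ v ∈ S₀, 2 ^ nfl v * (if natGenerator v ∣ M then 0 else (if ‖embCoeff g ι (natGenerator v)‖ < 1 then 2 else 0))) ≤ lamTwo 2 (PAway (Set.range ι) κ ρ S₀)) →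
    (
    open Literature.NumberTheory.EllipticCurves GreenbergSelmer GreenbergVatsal2000 Kobayashi2003 ModularForms Rank1Residual Literature.NumberTheory.GaloisRepresentations Literature.NumberTheory.Automorphic IsDedekindDomain NumberField Field Rat.HeightOneSpectrum PowerSeries Summit.BirchSwinnertonDyer.BirchSwinnertonDyer.Theorems.OnePair in ∀ (W : WeierstrassCurve ℚ) [W.IsElliptic] [W.IsGloballyMinimal], GoodSS W 2 → W.frobeniusTrace 2 = 0 → W.Δ < 0 → ∀ (M : ℕ) [NeZero M] (g : CuspForm (CongruenceSubgroup.Gamma0 M) 2) (ι : coeffField g →+* PadicAlgCl 2), Odd M → IsNewform0 g → IsCMForm (liftToGamma1 M 2 g) → cuspCoeff g 2 = 0 → (∀ ℓ : ℕ, ℓ.Prime → ¬ ℓ ∣ 2 * M * W.conductorNorm ℤ → ‖embCoeff g ι ℓ - (W.frobeniusTrace ℓ : PadicAlgCl 2)‖ < 1) → ∀ (κ : ZpExtension ℚ 2) (γ : absoluteGaloisGroup ℚ), κ.IsCyclotomic → κ.IsTopGenerator γ → IsCyclotomicVariable 2 γ → ∀ (S₀ : Finset (HeightOneSpectrum (RingOfIntegers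 ℚ))), (∀ v ∈ S₀, ((2 : ℕ) : RingOfIntegers ℚ) ∉ v.asIdeal) → (∀ v, ¬ W.HasGoodReductionAt v → v ∈ S₀) → (∀ v, natGenerator v ∣ M → v ∈ S₀) → ∀ (n : ℕ) (ρ : FramedGaloisRep ℚ (coeffO (Set.range ι)) 2) (Θ : ∀ v : HeightOneSpectrum (RingOfIntegers ℚ), ((2 : ℕ) : RingOfIntegers ℚ) ∈ v.asIdeal → (CofreeF (Set.range ι) ρ ≃+ (Fin n → ↥(W.geomPrimaryTorsion 2)))), (∀ v, ¬ natGenerator v ∣ 2 * M → ρ.IsUnramifiedAt v ∧ ∃ P : Polynomial (coeffO (Set.range ι)), P.map (padicCoeffIntegers (Set.range ι)).subtype = Polynomial.X ^ 2 - Polynomial.C (embCoeff g ι (natGenerator v)) * Polynomial.X + Polynomial.C ((natGenerator v : ℕ) : PadicAlgCl 2) ∧ ρ.HasFrobCharpolyAt v P) → ∀ (hΘ : ∀ v hv (δ : absoluteGaloisGroup (v.adicCompletion ℚ)) m i, Θ v hv (resGalOfEmb (closureEmb (K := ℚ) (v.adicCompletion ℚ)) δ • m) i = resGalOfEmb (closureEmb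 (K := ℚ) (v.adicCompletion ℚ)) δ • Θ v hv m i), ∀ (ϖ : (coeffO (Set.range ι))), Irreducible ϖ → ∀ (Sg : AddSubgroup (H1Γ (Set.range ι) κ ρ)) [Module (coeffO (Set.range ι)) ↥Sg], (∀ (a : (coeffO (Set.range ι))) (s : ↥Sg), ((a • s : ↥Sg) : H1Γ (Set.range ι) κ ρ) = scalarH1 κ.kerSubgroup (CofreeF (Set.range ι) ρ) a s) → (∀ y : H1Γ (Set.range ι) κ ρ, y ∈ Sg ↔ y ∈ plusSelmerSet (Set.range ι) W κ S₀ n ρ Θ) → (∀ (τ : absoluteGaloisGroup ℚ) (y : H1Γ (Set.range ι) κ ρ), y ∈ Sg → conjH1 κ.kerSubgroup (CofreeF (Set.range ι) ρ) τ y ∈ Sg) → (plusSelmerTorsionSet (Set.range ι) W κ S₀ n ρ Θ ϖ).Finite → ∀ (I : Kato2004.IwasawaH1DataCoeff (FramedGaloisRep.toGaloisRep ρ) 2 κ γ) [Module (coeffO (Set.range ι)) I.H] [IsScalarTower (coeffO (Set.range ι)) (IwasawaAlgebraO (Set.range ι)) I.H], (∀ (a : (coeffO (Set.range ι))) (x :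 I.H), a • x = (PowerSeries.C a : IwasawaAlgebraO (Set.range ι)) • x) → ∀ (π : OnePairPins (Set.range ι) W κ γ S₀ n ρ Θ hΘ I Sg) (hζ2 : ∀ k : ℕ, π.ζ (k + 1) ^ 2 = π.ζ k), ∀ [Module ℤ_[2] (Dloc (Set.range ι) κ ρ π.v)] (π₂ : AtTwoPins (Set.range ι) κ ρ S₀ W γ n Θ hΘ I Sg π) [∀ w : ↥S₀, Module ℤ_[2] (Dloc (Set.range ι) κ ρ (w : HeightOneSpectrum (RingOfIntegers ℚ)))] (πₐ : AwayPins (Set.range ι) κ ρ S₀ W γ n Θ hΘ I Sg π), ∀ (x : I.H) (s : H1Γ (Set.range ι) κ ρ), s ∈ selRelSubgroup (Set.range ι) κ ρ S₀ → π₂.c₂ (π.locd₂ x) (locKer (Set.range ι) κ ρ π.v s) + ∑ w : ↥S₀, ∑ᶠ c : Cosets κ (w : HeightOneSpectrum (RingOfIntegers ℚ)), πₐ.locdS x w c (locAway (Set.range ι) κ ρ S₀ s w c) = 0) →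
    (
    open Literature.NumberTheory.EllipticCurves GreenbergSelmer GreenbergVatsal2000 Kobayashi2003 ModularForms Rank1Residual Literature.NumberTheory.GaloisRepresentations Literature.NumberTheory.Automorphic IsDedekindDomain NumberField Field Rat.HeightOneSpectrum PowerSeries Summit.BirchSwinnertonDyer.BirchSwinnertonDyer.Theorems.OnePair in ∀ (W : WeierstrassCurve ℚ) [W.IsElliptic] [W.IsGloballyMinimal], GoodSS W 2 → W.frobeniusTrace 2 = 0 → W.Δ < 0 → ∀ (M : ℕ) [NeZero M] (g : CuspForm (CongruenceSubgroup.Gamma0 M) 2) (ι : coeffField g →+* PadicAlgCl 2), Odd M → IsNewform0 g → IsCMForm (liftToGamma1 M 2 g) → cuspCoeff g 2 = 0 → (∀ ℓ : ℕ, ℓ.Prime → ¬ ℓ ∣ 2 * M * W.conductorNorm ℤ → ‖embCoeff g ι ℓ - (W.frobeniusTrace ℓ : PadicAlgCl 2)‖ < 1) → ∀ (κ : ZpExtension ℚ 2) (γ : absoluteGaloisGroup ℚ), κ.IsCyclotomic → κ.IsTopGenerator γ → IsCyclotomicVariable 2 γ → ∀ (S₀ : Finset (HeightOneSpectrum (RingOfIntegers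 ℚ))), (∀ v ∈ S₀, ((2 : ℕ) : RingOfIntegers ℚ) ∉ v.asIdeal) → (∀ v, ¬ W.HasGoodReductionAt v → v ∈ S₀) → (∀ v, natGenerator v ∣ M → v ∈ S₀) → ∀ (n : ℕ) (ρ : FramedGaloisRep ℚ (coeffO (Set.range ι)) 2) (Θ : ∀ v : HeightOneSpectrum (RingOfIntegers ℚ), ((2 : ℕ) : RingOfIntegers ℚ) ∈ v.asIdeal → (CofreeF (Set.range ι) ρ ≃+ (Fin n → ↥(W.geomPrimaryTorsion 2)))), (∀ v, ¬ natGenerator v ∣ 2 * M → ρ.IsUnramifiedAt v ∧ ∃ P : Polynomial (coeffO (Set.range ι)), P.map (padicCoeffIntegers (Set.range ι)).subtype = Polynomial.X ^ 2 - Polynomial.C (embCoeff g ι (natGenerator v)) * Polynomial.X + Polynomial.C ((natGenerator v : ℕ) : PadicAlgCl 2) ∧ ρ.HasFrobCharpolyAt v P) → ∀ (hΘ : ∀ v hv (δ : absoluteGaloisGroup (v.adicCompletion ℚ)) m i, Θ v hv (resGalOfEmb (closureEmb (K := ℚ) (v.adicCompletion ℚ)) δ • m) i = resGalOfEmb (closureEmb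 (K := ℚ) (v.adicCompletion ℚ)) δ • Θ v hv m i), ∀ (ϖ : (coeffO (Set.range ι))), Irreducible ϖ → ∀ (Sg : AddSubgroup (H1Γ (Set.range ι) κ ρ)) [Module (coeffO (Set.range ι)) ↥Sg], (∀ (a : (coeffO (Set.range ι))) (s : ↥Sg), ((a • s : ↥Sg) : H1Γ (Set.range ι) κ ρ) = scalarH1 κ.kerSubgroup (CofreeF (Set.range ι) ρ) a s) → (∀ y : H1Γ (Set.range ι) κ ρ, y ∈ Sg ↔ y ∈ plusSelmerSet (Set.range ι) W κ S₀ n ρ Θ) → (∀ (τ : absoluteGaloisGroup ℚ) (y : H1Γ (Set.range ι) κ ρ), y ∈ Sg → conjH1 κ.kerSubgroup (CofreeF (Set.range ι) ρ) τ y ∈ Sg) → (plusSelmerTorsionSet (Set.range ι) W κ S₀ n ρ Θ ϖ).Finite → ∀ (I : Kato2004.IwasawaH1DataCoeff (FramedGaloisRep.toGaloisRep ρ) 2 κ γ) [Module (coeffO (Set.range ι)) I.H] [IsScalarTower (coeffO (Set.range ι)) (IwasawaAlgebraO (Set.range ι)) I.H], (∀ (a : (coeffO (Set.range ι))) (x :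 I.H), a • x = (PowerSeries.C a : IwasawaAlgebraO (Set.range ι)) • x) → ∀ (π : OnePairPins (Set.range ι) W κ γ S₀ n ρ Θ hΘ I Sg) (hζ2 : ∀ k : ℕ, π.ζ (k + 1) ^ 2 = π.ζ k), ∀ [Module ℤ_[2] (Dloc (Set.range ι) κ ρ π.v)] (π₂ : AtTwoPins (Set.range ι) κ ρ S₀ W γ n Θ hΘ I Sg π) [∀ w : ↥S₀, Module ℤ_[2] (Dloc (Set.range ι) κ ρ (w : HeightOneSpectrum (RingOfIntegers ℚ)))] (πₐ : AwayPins (Set.range ι) κ ρ S₀ W γ n Θ hΘ I Sg π), ∀ z : (Fin n → ↥(Sprung2012.localTowerPointsOfEmb κ (closureEmb (K := ℚ) (π.v.adicCompletion ℚ)) W)) →+ ℤ_[2], (∀ s : H1Γ (Set.range ι) κ ρ, s ∈ selRelSubgroup (Set.range ι) κ ρ S₀ → π₂.c₂ z (locKer (Set.range ι) κ ρ π.v s) = 0) → ∃ a : ℤ_[2], a ≠ 0 ∧ ∃ x : I.H, πₐ.locdS x = 0 ∧ a • z = π.locd₂ x) →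
    (
    open Literature.NumberTheory.EllipticCurves GreenbergSelmer GreenbergVatsal2000 Kobayashi2003 ModularForms Rank1Residual Literature.NumberTheory.GaloisRepresentations Literature.NumberTheory.Automorphic IsDedekindDomain NumberField Field Rat.HeightOneSpectrum PowerSeries Summit.BirchSwinnertonDyer.BirchSwinnertonDyer.Theorems.OnePair in ∀ (W : WeierstrassCurve ℚ) [W.IsElliptic] [W.IsGloballyMinimal], GoodSS W 2 → W.frobeniusTrace 2 = 0 → W.Δ < 0 → ∀ (M : ℕ) [NeZero M] (g : CuspForm (CongruenceSubgroup.Gamma0 M) 2) (ι : coeffField g →+* PadicAlgCl 2), Odd M → IsNewform0 g → IsCMForm (liftToGamma1 M 2 g) → cuspCoeff g 2 = 0 → (∀ ℓ : ℕ, ℓ.Prime → ¬ ℓ ∣ 2 * M * W.conductorNorm ℤ → ‖embCoeff g ι ℓ - (W.frobeniusTrace ℓ : PadicAlgCl 2)‖ < 1) → ∀ (κ : ZpExtension ℚ 2) (γ : absoluteGaloisGroup ℚ), κ.IsCyclotomic → κ.IsTopGenerator γ → IsCyclotomicVariable 2 γ → ∀ (S₀ : Finset (HeightOneSpectrum (RingOfIntegers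 ℚ))), (∀ v ∈ S₀, ((2 : ℕ) : RingOfIntegers ℚ) ∉ v.asIdeal) → (∀ v, ¬ W.HasGoodReductionAt v → v ∈ S₀) → (∀ v, natGenerator v ∣ M → v ∈ S₀) → ∀ (n : ℕ) (ρ : FramedGaloisRep ℚ (coeffO (Set.range ι)) 2) (Θ : ∀ v : HeightOneSpectrum (RingOfIntegers ℚ), ((2 : ℕ) : RingOfIntegers ℚ) ∈ v.asIdeal → (CofreeF (Set.range ι) ρ ≃+ (Fin n → ↥(W.geomPrimaryTorsion 2)))), (∀ v, ¬ natGenerator v ∣ 2 * M → ρ.IsUnramifiedAt v ∧ ∃ P : Polynomial (coeffO (Set.range ι)), P.map (padicCoeffIntegers (Set.range ι)).subtype = Polynomial.X ^ 2 - Polynomial.C (embCoeff g ι (natGenerator v)) * Polynomial.X + Polynomial.C ((natGenerator v : ℕ) : PadicAlgCl 2) ∧ ρ.HasFrobCharpolyAt v P) → ∀ (hΘ : ∀ v hv (δ : absoluteGaloisGroup (v.adicCompletion ℚ)) m i, Θ v hv (resGalOfEmb (closureEmb (K := ℚ) (v.adicCompletion ℚ)) δ • m) i = resGalOfEmb (closureEmb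 (K := ℚ) (v.adicCompletion ℚ)) δ • Θ v hv m i), ∀ (ϖ : (coeffO (Set.range ι))), Irreducible ϖ → ∀ (Sg : AddSubgroup (H1Γ (Set.range ι) κ ρ)) [Module (coeffO (Set.range ι)) ↥Sg], (∀ (a : (coeffO (Set.range ι))) (s : ↥Sg), ((a • s : ↥Sg) : H1Γ (Set.range ι) κ ρ) = scalarH1 κ.kerSubgroup (CofreeF (Set.range ι) ρ) a s) → (∀ y : H1Γ (Set.range ι) κ ρ, y ∈ Sg ↔ y ∈ plusSelmerSet (Set.range ι) W κ S₀ n ρ Θ) → (∀ (τ : absoluteGaloisGroup ℚ) (y : H1Γ (Set.range ι) κ ρ), y ∈ Sg → conjH1 κ.kerSubgroup (CofreeF (Set.range ι) ρ) τ y ∈ Sg) → (plusSelmerTorsionSet (Set.range ι) W κ S₀ n ρ Θ ϖ).Finite → ∀ (I : Kato2004.IwasawaH1DataCoeff (FramedGaloisRep.toGaloisRep ρ) 2 κ γ) [Module (coeffO (Set.range ι)) I.H] [IsScalarTower (coeffO (Set.range ι)) (IwasawaAlgebraO (Set.range ι)) I.H], (∀ (a : (coeffO (Set.range ι))) (x :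 I.H), a • x = (PowerSeries.C a : IwasawaAlgebraO (Set.range ι)) • x) → ∀ (π : OnePairPins (Set.range ι) W κ γ S₀ n ρ Θ hΘ I Sg) (hζ2 : ∀ k : ℕ, π.ζ (k + 1) ^ 2 = π.ζ k), ∀ [∀ w : ↥S₀, Module ℤ_[2] (Dloc (Set.range ι) κ ρ (w : HeightOneSpectrum (RingOfIntegers ℚ)))] (πₐ : AwayPins (Set.range ι) κ ρ S₀ W γ n Θ hΘ I Sg π), ∀ χ : PAway (Set.range ι) κ ρ S₀, (∀ s : H1Γ (Set.range ι) κ ρ, s ∈ selRelSubgroup (Set.range ι) κ ρ S₀ → locKer (Set.range ι) κ ρ π.v s = 0 → ∑ w : ↥S₀, ∑ᶠ c : Cosets κ (w : HeightOneSpectrum (RingOfIntegers ℚ)), χ w c (locAway (Set.range ι) κ ρ S₀ s w c) = 0) → ∃ a : ℤ_[2], a ≠ 0 ∧ ∃ x : I.H, a • χ = πₐ.locdS x) →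
    (
    open Literature.NumberTheory.EllipticCurves GreenbergSelmer GreenbergVatsal2000 Kobayashi2003 ModularForms Rank1Residual Literature.NumberTheory.GaloisRepresentations Literature.NumberTheory.Automorphic IsDedekindDomain NumberField Field Rat.HeightOneSpectrum PowerSeries in ∀ (W : WeierstrassCurve ℚ) [W.IsElliptic] [W.IsGloballyMinimal], ¬ W.HasCM → W.analyticRank = 0 → GoodSS W 2 → W.frobeniusTrace 2 = 0 → W.Δ < 0 → ∀ (M : ℕ) [NeZero M] (g : CuspForm (CongruenceSubgroup.Gamma0 M) 2) (ι : coeffField g →+* PadicAlgCl 2) (Ω : ℂ), Odd M → IsNewform0 g → IsCMForm (liftToGamma1 M 2 g) → cuspCoeff g 2 = 0 → IsCohomologicalPlusPeriod g ι Ω → (∀ ℓ : ℕ, ℓ.Prime → ¬ ℓ ∣ 2 * M * W.conductorNorm ℤ → ‖embCoeff g ι ℓ - (W.frobeniusTrace ℓ : PadicAlgCl 2)‖ < 1) → ∀ (κ : ZpExtension ℚ 2) (γ : absoluteGaloisGroup ℚ), κ.IsCyclotomic → κ.IsTopGenerator γ → IsCyclotomicVariable 2 γ → ∀ (S₀ :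 Finset (HeightOneSpectrum (RingOfIntegers ℚ))), (∀ v ∈ S₀, ((2 : ℕ) : RingOfIntegers ℚ) ∉ v.asIdeal) → (∀ v, ¬ W.HasGoodReductionAt v → v ∈ S₀) → (∀ v, natGenerator v ∣ M → v ∈ S₀) → ∀ (Lp Lm : IwasawaAlgebraO (Set.range ι)) (d : ℕ), IsPollackPairK g ι Ω Lp Lm → (∀ k, ‖coeff k (iwasawaOToPowerSeries (Set.range ι) Lm)‖ ≤ ‖coeff d (iwasawaOToPowerSeries (Set.range ι) Lm)‖) → (∀ k < d, ‖coeff k (iwasawaOToPowerSeries (Set.range ι) Lm)‖ < ‖coeff d (iwasawaOToPowerSeries (Set.range ι) Lm)‖) → ∀ (n : ℕ) (ρ : FramedGaloisRep ℚ ↥(padicCoeffIntegers (Set.range ι)) 2) (Θ : ∀ v : HeightOneSpectrum (RingOfIntegers ℚ), ((2 : ℕ) : RingOfIntegers ℚ) ∈ v.asIdeal → (Cofree ρ ↥(padicCoeffField (Set.range ι)) ≃+ (Fin n → ↥(W.geomPrimaryTorsion 2)))), (∀ v, ¬ natGenerator v ∣ 2 * M → ρ.IsUnramifiedAt v ∧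 ∃ P : Polynomial ↥(padicCoeffIntegers (Set.range ι)), P.map (padicCoeffIntegers (Set.range ι)).subtype = Polynomial.X ^ 2 - Polynomial.C (embCoeff g ι (natGenerator v)) * Polynomial.X + Polynomial.C ((natGenerator v : ℕ) : PadicAlgCl 2) ∧ ρ.HasFrobCharpolyAt v P) → ∀ (hΘ : ∀ v hv (δ : absoluteGaloisGroup (v.adicCompletion ℚ)) m i, Θ v hv (resGalOfEmb (closureEmb (K := ℚ) (v.adicCompletion ℚ)) δ • m) i = resGalOfEmb (closureEmb (K := ℚ) (v.adicCompletion ℚ)) δ • Θ v hv m i), ∀ (ϖ : ↥(padicCoeffIntegers (Set.range ι))), Irreducible ϖ → ∀ (Sg : AddSubgroup (subgroupH1 κ.kerSubgroup (Cofree ρ ↥(padicCoeffField (Set.range ι))))) [Module ↥(padicCoeffIntegers (Set.range ι)) ↥Sg], (∀ (a : ↥(padicCoeffIntegers (Set.range ι))) (s : ↥Sg), ((a • s : ↥Sg) : subgroupH1 κ.kerSubgroup (Cofree ρ ↥(padicCoeffField (Set.range ι)))) = scalarH1 κ.kerSubgroup (Cofree ρ ↥(padicCoeffField (Set.range ι)))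 a s) → (∀ y : subgroupH1 κ.kerSubgroup (Cofree ρ ↥(padicCoeffField (Set.range ι))), y ∈ Sg ↔ y ∈ {y : subgroupH1 κ.kerSubgroup (Cofree ρ ↥(padicCoeffField (Set.range ι))) | y ∈ unramifiedOutside κ.kerSubgroup (Cofree ρ ↥(padicCoeffField (Set.range ι))) 2 ↑S₀ ∧ (∀ w σ, conjH1 κ.kerSubgroup (Cofree ρ ↥(padicCoeffField (Set.range ι))) σ y ∈ infKer κ.kerSubgroup (Cofree ρ ↥(padicCoeffField (Set.range ι))) w) ∧ (∀ v hv σ, ∃ (φ : _) (Q : Fin n → localPoints W (v.adicCompletion ℚ)) (k : ℕ), oneCocycleClass (discreteTopRep ↥κ.kerSubgroup (Cofree ρ ↥(padicCoeffField (Set.range ι)))) φ = conjH1 κ.kerSubgroup (Cofree ρ ↥(padicCoeffField (Set.range ι))) σ y ∧ (∀ i, (2 ^ k) • Q i ∈ ⨆ m : ℕ, signedLocalPoints κ (v.adicCompletion ℚ) W 1 m) ∧ ∀ τ i, pointsMapOfEmb W (closureEmb (K := ℚ) (v.adicCompletion ℚ)) (((Θ v hv (φ.1 (resGalSubgroupOfEmb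 κ.kerSubgroup (closureEmb (K := ℚ) (v.adicCompletion ℚ)) τ))) i : ↥(W.geomPrimaryTorsion 2)) : W.geomPoints) = (τ : absoluteGaloisGroup (v.adicCompletion ℚ)) • Q i - Q i)}) → (∀ (τ : absoluteGaloisGroup ℚ) (y : subgroupH1 κ.kerSubgroup (Cofree ρ ↥(padicCoeffField (Set.range ι)))), y ∈ Sg → conjH1 κ.kerSubgroup (Cofree ρ ↥(padicCoeffField (Set.range ι))) τ y ∈ Sg) → ({y : subgroupH1 κ.kerSubgroup (Cofree ρ ↥(padicCoeffField (Set.range ι))) | y ∈ unramifiedOutside κ.kerSubgroup (Cofree ρ ↥(padicCoeffField (Set.range ι))) 2 ↑S₀ ∧ (∀ w σ, conjH1 κ.kerSubgroup (Cofree ρ ↥(padicCoeffField (Set.range ι))) σ y ∈ infKer κ.kerSubgroup (Cofree ρ ↥(padicCoeffField (Set.range ι))) w) ∧ (∀ v hv σ, ∃ (φ : _) (Q : Fin n → localPoints W (v.adicCompletion ℚ)) (k : ℕ), oneCocycleClass (discreteTopRep ↥κ.kerSubgroup (Cofree ρ ↥(padicCoeffField (Set.range ι)))) φ = conjH1 κ.kerSubgroup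 (Cofree ρ ↥(padicCoeffField (Set.range ι))) σ y ∧ (∀ i, (2 ^ k) • Q i ∈ ⨆ m : ℕ, signedLocalPoints κ (v.adicCompletion ℚ) W 1 m) ∧ ∀ τ i, pointsMapOfEmb W (closureEmb (K := ℚ) (v.adicCompletion ℚ)) (((Θ v hv (φ.1 (resGalSubgroupOfEmb κ.kerSubgroup (closureEmb (K := ℚ) (v.adicCompletion ℚ)) τ))) i : ↥(W.geomPrimaryTorsion 2)) : W.geomPoints) = (τ : absoluteGaloisGroup (v.adicCompletion ℚ)) • Q i - Q i) ∧ scalarH1 κ.kerSubgroup (Cofree ρ ↥(padicCoeffField (Set.range ι))) ϖ y = 0} : Set _).Finite → ∀ (v : HeightOneSpectrum (RingOfIntegers ℚ)) (hv : ((2 : ℕ) : RingOfIntegers ℚ) ∈ v.asIdeal) (I : Kato2004.IwasawaH1DataCoeff (FramedGaloisRep.toGaloisRep ρ) 2 κ γ) [Module ↥(padicCoeffIntegers (Set.range ι)) I.H] [IsScalarTower ↥(padicCoeffIntegers (Set.range ι)) (IwasawaAlgebraO (Set.range ι)) I.H], (∀ (a : ↥(padicCoeffIntegers (Set.range ι)))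 (x : I.H), a • x = (PowerSeries.C a : IwasawaAlgebraO (Set.range ι)) • x) → ∀ (t₀ : ↥(padicCoeffIntegers (Set.range ι)) →+ ℤ_[2]), (∀ (c : ℤ_[2]) (a : ↥(padicCoeffIntegers (Set.range ι))), t₀ (padicIntToCoeffIntegers (Set.range ι) c * a) = c * t₀ a) → ∀ (nb : ℕ) (bO bO' : Fin nb → ↥(padicCoeffIntegers (Set.range ι))), (∀ a : ↥(padicCoeffIntegers (Set.range ι)), a = ∑ i, padicIntToCoeffIntegers (Set.range ι) (t₀ (a * bO' i)) * bO i) → ∀ (ζ : ℕ → AlgebraicClosure ℚ), (∀ k, IsPrimitiveRoot (ζ k) (2 ^ k)) → ∀ (ePk : ∀ k : ℕ, ↥(AddSubgroup.torsionBy (Cofree ρ ↥(padicCoeffField (Set.range ι))) ((2 ^ k : ℕ) : ℤ)) → ↥(AddSubgroup.torsionBy (Cofree ρ ↥(padicCoeffField (Set.range ι))) ((2 ^ k : ℕ) : ℤ)) → AlgebraicClosure ℚ) (hμPk : ∀ k a b, ePk k a b ^ (2 ^ k) = 1) (hadd₁Pk : ∀ k a₁ a₂ b, ePk k (a₁ +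 a₂) b = ePk k a₁ b * ePk k a₂ b) (hadd₂Pk : ∀ k a b₁ b₂, ePk k a (b₁ + b₂) = ePk k a b₁ * ePk k a b₂) (hgalPk : ∀ k (σ : absoluteGaloisGroup ℚ) (a b : ↥(AddSubgroup.torsionBy (Cofree ρ ↥(padicCoeffField (Set.range ι))) ((2 ^ k : ℕ) : ℤ))), σ • ePk k a b = ePk k (cofreeTorsionGaloisModule (Set.range ι) ρ _ σ a) (cofreeTorsionGaloisModule (Set.range ι) ρ _ σ b)), (∀ k (s t : Fin 2 → ↥(padicCoeffIntegers (Set.range ι))), ePk k (divPowCofreeMkTorsion (Set.range ι) ρ k s) (divPowCofreeMkTorsion (Set.range ι) ρ k t) = ζ k ^ (PadicInt.toZModPow k (t₀ (s 0 * t 1 - s 1 * t 0))).val) → ∀ (pair : ∀ m : ℕ, H1 (FramedGaloisRep.toGaloisRep ρ) (κ.layerSubgroup m) →+ ((Fin n → ↥(localLayerPointsOfEmb κ (closureEmb (K := ℚ) (v.adicCompletion ℚ)) W m)) →+ ℤ_[2])), (∀ (m k : ℕ) (x : H1 (FramedGaloisRep.toGaloisRep ρ) (κ.layerSubgroup m))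 (Q : Fin n → ↥(localLayerPointsOfEmb κ (closureEmb (K := ℚ) (v.adicCompletion ℚ)) W m)), PadicInt.toZModPow k (pair m x Q) = CyclotomicLayer.rhoLayerPairingPk (Set.range ι) ρ W ePk hμPk hadd₁Pk hadd₂Pk hgalPk (Θ v hv) κ v (hΘ v hv) m k x Q) → ∀ (locd₂ : I.H →+ ((Fin n → ↥(Sprung2012.localTowerPointsOfEmb κ (closureEmb (K := ℚ) (v.adicCompletion ℚ)) W)) →+ ℤ_[2])), (∀ (m : ℕ) (x : I.H) (Q : Fin n → localPoints W (v.adicCompletion ℚ)) (hQ : ∀ i, Q i ∈ localLayerPointsOfEmb κ (closureEmb (K := ℚ) (v.adicCompletion ℚ)) W m), locd₂ x (fun i => ⟨Q i, Sprung2012.localLayerPointsOfEmb_le_localTowerPointsOfEmb κ (closureEmb (K := ℚ) (v.adicCompletion ℚ)) W m (hQ i)⟩) = pair m (I.proj m x) (fun i => ⟨Q i, hQ i⟩)) → ∀ (col : (↥(Sprung2012.localTowerPointsOfEmb κ (closureEmb (K := ℚ) (v.adicCompletion ℚ)) W) →+ ℤ_[2]) →ₗ[ℤ_[2]] PowerSeries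 ℤ_[2]), (∃ (gH : absoluteGaloisGroup (v.adicCompletion ℚ)) (dH : ℕ → localPoints W (v.adicCompletion ℚ)) (hdA : ∀ m j, gH ^ j • dH m ∈ Sprung2012.localTowerPointsOfEmb κ (closureEmb (K := ℚ) (v.adicCompletion ℚ)) W), κ.IsTopGenerator (resGalOfEmb (closureEmb (K := ℚ) (v.adicCompletion ℚ)) gH) ∧ (∀ m, dH m ∈ localLayerPointsOfEmb κ (closureEmb (K := ℚ) (v.adicCompletion ℚ)) W m) ∧ (∀ m, localTraceOfEmb κ (closureEmb (K := ℚ) (v.adicCompletion ℚ)) W (m + 1) (m + 2) (dH (m + 2)) = -dH m) ∧ (∀ b ∈ localLayerPointsOfEmb κ (closureEmb (K := ℚ) (v.adicCompletion ℚ)) W 0, dH 0 ≠ 2 • b) ∧ (∀ (z : ↥(Sprung2012.localTowerPointsOfEmb κ (closureEmb (K := ℚ) (v.adicCompletion ℚ)) W) →+ ℤ_[2]) (m : ℕ), (((cyclotomicOmega 2 (2 * m)).map (Int.castRingHom ℤ_[2]) : Polynomial ℤ_[2]) : PowerSeries ℤ_[2]) ∣ ((∑ j ∈ Finset.range (2 ^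 (2 * m)), Polynomial.C (z ⟨gH ^ j • dH (2 * m), hdA (2 * m) j⟩) * (Polynomial.X + 1) ^ j : Polynomial ℤ_[2]) : PowerSeries ℤ_[2]) + (-1 : PowerSeries ℤ_[2]) ^ m * (((cyclotomicOmegaMinus 2 (2 * m)).map (Int.castRingHom ℤ_[2]) : Polynomial ℤ_[2]) : PowerSeries ℤ_[2]) * col z) ∧ (∀ (z : ↥(Sprung2012.localTowerPointsOfEmb κ (closureEmb (K := ℚ) (v.adicCompletion ℚ)) W) →+ ℤ_[2]) (Lz : PowerSeries ℤ_[2]), (∀ m : ℕ, (((cyclotomicOmega 2 (2 * m)).map (Int.castRingHom ℤ_[2]) : Polynomial ℤ_[2]) : PowerSeries ℤ_[2]) ∣ ((∑ j ∈ Finset.range (2 ^ (2 * m)), Polynomial.C (z ⟨gH ^ j • dH (2 * m), hdA (2 * m) j⟩) * (Polynomial.X + 1) ^ j : Polynomial ℤ_[2]) : PowerSeries ℤ_[2]) + (-1 : PowerSeries ℤ_[2]) ^ m * (((cyclotomicOmegaMinus 2 (2 * m)).map (Int.castRingHom ℤ_[2]) : Polynomial ℤ_[2]) : PowerSeries ℤ_[2])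 * Lz) → Lz = col z)) → Function.Surjective col → (∀ z : ↥(Sprung2012.localTowerPointsOfEmb κ (closureEmb (K := ℚ) (v.adicCompletion ℚ)) W) →+ ℤ_[2], col z = 0 ↔ ∀ (m : ℕ) (x : localPoints W (v.adicCompletion ℚ)) (hx : x ∈ signedLocalPoints κ (v.adicCompletion ℚ) W 1 m), z ⟨x, Sprung2012.localLayerPointsOfEmb_le_localTowerPointsOfEmb κ (closureEmb (K := ℚ) (v.adicCompletion ℚ)) W m (signedLocalPointsOfEmb_le κ (closureEmb (K := ℚ) (v.adicCompletion ℚ)) W 1 m hx)⟩ = 0) → ∀ (f : ℕ) (B : (Fin f → ℤ_[2]) ≃+ ↥(padicCoeffIntegers (Set.range ι))), (∀ (c : ℤ_[2]) (y : Fin f → ℤ_[2]), B (c • y) = padicIntToCoeffIntegers (Set.range ι) c * B y) → ∀ (Sel₀ : Submodule ↥(padicCoeffIntegers (Set.range ι)) ↥Sg), (∀ s : ↥Sg, s ∈ Sel₀ ↔ (∀ (v' : HeightOneSpectrum (RingOfIntegers ℚ)) (hv' : ((2 : ℕ) : RingOfIntegers ℚ) ∈ v'.asIdeal) (σ : absoluteGaloisGroup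 ℚ), ∃ (φ : contOneCocycles (discreteTopRep ↥κ.kerSubgroup (Cofree ρ ↥(padicCoeffField (Set.range ι))))) (Q : Fin n → localPoints W (v'.adicCompletion ℚ)) (k : ℕ), oneCocycleClass (discreteTopRep ↥κ.kerSubgroup (Cofree ρ ↥(padicCoeffField (Set.range ι)))) φ = conjH1 κ.kerSubgroup (Cofree ρ ↥(padicCoeffField (Set.range ι))) σ (s : subgroupH1 κ.kerSubgroup (Cofree ρ ↥(padicCoeffField (Set.range ι)))) ∧ (∀ i, (2 ^ k) • Q i ∈ (⊥ : AddSubgroup (localPoints W (v'.adicCompletion ℚ)))) ∧ ∀ (τ : ↥(localSubgroupOfEmb κ.kerSubgroup (closureEmb (K := ℚ) (v'.adicCompletion ℚ)))) (i : Fin n), pointsMapOfEmb W (closureEmb (K := ℚ) (v'.adicCompletion ℚ)) ((Θ v' hv' (φ.1 (resGalSubgroupOfEmb κ.kerSubgroup (closureEmb (K := ℚ) (v'.adicCompletion ℚ)) τ)) i : ↥(W.geomPrimaryTorsion 2)) : W.geomPoints) = (τ : absoluteGaloisGroup (v'.adicCompletion ℚ)) • Q i - Q i) ∧ (∀ w ∈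 S₀, ∀ σ : absoluteGaloisGroup ℚ, conjH1 κ.kerSubgroup (Cofree ρ ↥(padicCoeffField (Set.range ι))) σ (s : subgroupH1 κ.kerSubgroup (Cofree ρ ↥(padicCoeffField (Set.range ι)))) ∈ unramifiedKer κ.kerSubgroup (Cofree ρ ↥(padicCoeffField (Set.range ι))) w)) → ∃ pair₂ : ((Fin n → ↥(Sprung2012.localTowerPointsOfEmb κ (closureEmb (K := ℚ) (v.adicCompletion ℚ)) W)) →+ ℤ_[2]) →+ CharacterModule ↥Sg, (∀ (c : ℤ_[2]) (t : (Fin n → ↥(Sprung2012.localTowerPointsOfEmb κ (closureEmb (K := ℚ) (v.adicCompletion ℚ)) W)) →+ ℤ_[2]) (s : ↥Sg), pair₂ (c • t) s = pair₂ t (padicIntToCoeffIntegers (Set.range ι) c • s)) ∧ (∀ (t : (Fin n → ↥(Sprung2012.localTowerPointsOfEmb κ (closureEmb (K := ℚ) (v.adicCompletion ℚ)) W)) →+ ℤ_[2]) (s : ↥Sg) (φ : contOneCocycles (discreteTopRep ↥κ.kerSubgroup (Cofree ρ ↥(padicCoeffField (Set.range ι))))) (Q : Fin n → localPoints W (v.adicCompletion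 ℚ)) (k : ℕ) (hQ : ∀ i, (2 ^ k) • Q i ∈ Sprung2012.localTowerPointsOfEmb κ (closureEmb (K := ℚ) (v.adicCompletion ℚ)) W), oneCocycleClass (discreteTopRep ↥κ.kerSubgroup (Cofree ρ ↥(padicCoeffField (Set.range ι)))) φ = (s : subgroupH1 κ.kerSubgroup (Cofree ρ ↥(padicCoeffField (Set.range ι)))) → (∀ (τ : ↥(localSubgroupOfEmb κ.kerSubgroup (closureEmb (K := ℚ) (v.adicCompletion ℚ)))) (i : Fin n), pointsMapOfEmb W (closureEmb (K := ℚ) (v.adicCompletion ℚ)) ((Θ v hv (φ.1 (resGalSubgroupOfEmb κ.kerSubgroup (closureEmb (K := ℚ) (v.adicCompletion ℚ)) τ)) i : ↥(W.geomPrimaryTorsion 2)) : W.geomPoints) = (τ : absoluteGaloisGroup (v.adicCompletion ℚ)) • Q i - Q i) → pair₂ t s = (PadicInt.toZModPow k (t (fun i => ⟨(2 ^ k) • Q i, hQ i⟩))).val • ((((2 : ℚ) ^ k)⁻¹ : ℚ) : AddCircle (1 : ℚ))) ∧ (∀ t : (Fin n → ↥(Sprung2012.localTowerPointsOfEmb κ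 (closureEmb (K := ℚ) (v.adicCompletion ℚ)) W)) →+ ℤ_[2], (∀ i : Fin n, col (t.comp (AddMonoidHom.single (fun _ : Fin n => ↥(Sprung2012.localTowerPointsOfEmb κ (closureEmb (K := ℚ) (v.adicCompletion ℚ)) W)) i)) = 0) → pair₂ t = 0)) →
    open Literature.NumberTheory.EllipticCurves GreenbergSelmer GreenbergVatsal2000 Kobayashi2003 ModularForms Rank1Residual Literature.NumberTheory.GaloisRepresentations Literature.NumberTheory.Automorphic IsDedekindDomain NumberField Field Rat.HeightOneSpectrum PowerSeries in ∀ (W : WeierstrassCurve ℚ) [W.IsElliptic] [W.IsGloballyMinimal], ¬ W.HasCM → W.analyticRank = 0 → GoodSS W 2 → W.frobeniusTrace 2 = 0 → W.Δ < 0 → ∀ (M : ℕ) [NeZero M] (g : CuspForm (CongruenceSubgroup.Gamma0 M) 2) (ι : coeffField g →+* PadicAlgCl 2) (Ω : ℂ), Odd M → IsNewform0 g → IsCMForm (liftToGamma1 M 2 g) → cuspCoeff g 2 = 0 → IsCohomologicalPlusPeriod g ι Ω → (∀ ℓ : ℕ, ℓ.Prime → ¬ ℓ ∣ 2 * M * W.conductorNorm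 ℤ → ‖embCoeff g ι ℓ - (W.frobeniusTrace ℓ : PadicAlgCl 2)‖ < 1) → ∀ (κ : ZpExtension ℚ 2) (γ : absoluteGaloisGroup ℚ), κ.IsCyclotomic → κ.IsTopGenerator γ → IsCyclotomicVariable 2 γ → ∀ (S₀ : Finset (HeightOneSpectrum (RingOfIntegers ℚ))), (∀ v ∈ S₀, ((2 : ℕ) : RingOfIntegers ℚ) ∉ v.asIdeal) → (∀ v, ¬ W.HasGoodReductionAt v → v ∈ S₀) → (∀ v, natGenerator v ∣ M → v ∈ S₀) → ∀ (Lp Lm : IwasawaAlgebraO (Set.range ι)) (d : ℕ), IsPollackPairK g ι Ω Lp Lm → (∀ k, ‖coeff k (iwasawaOToPowerSeries (Set.range ι) Lm)‖ ≤ ‖coeff d (iwasawaOToPowerSeries (Set.range ι) Lm)‖) → (∀ k < d, ‖coeff k (iwasawaOToPowerSeries (Set.range ι) Lm)‖ < ‖coeff d (iwasawaOToPowerSeries (Set.range ι) Lm)‖) → ∀ (n : ℕ) (ρ : FramedGaloisRep ℚ ↥(padicCoeffIntegers (Set.range ι)) 2) (Θ : ∀ v : HeightOneSpectrum (RingOfIntegers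 ℚ), ((2 : ℕ) : RingOfIntegers ℚ) ∈ v.asIdeal → (Cofree ρ ↥(padicCoeffField (Set.range ι)) ≃+ (Fin n → ↥(W.geomPrimaryTorsion 2)))), (∀ v, ¬ natGenerator v ∣ 2 * M → ρ.IsUnramifiedAt v ∧ ∃ P : Polynomial ↥(padicCoeffIntegers (Set.range ι)), P.map (padicCoeffIntegers (Set.range ι)).subtype = Polynomial.X ^ 2 - Polynomial.C (embCoeff g ι (natGenerator v)) * Polynomial.X + Polynomial.C ((natGenerator v : ℕ) : PadicAlgCl 2) ∧ ρ.HasFrobCharpolyAt v P) → ∀ (hΘ : ∀ v hv (δ : absoluteGaloisGroup (v.adicCompletion ℚ)) m i, Θ v hv (resGalOfEmb (closureEmb (K := ℚ) (v.adicCompletion ℚ)) δ • m) i = resGalOfEmb (closureEmb (K := ℚ) (v.adicCompletion ℚ)) δ • Θ v hv m i), ∀ (ϖ : ↥(padicCoeffIntegers (Set.range ι))), Irreducible ϖ → ∀ (Sg : AddSubgroup (subgroupH1 κ.kerSubgroup (Cofree ρ ↥(padicCoeffField (Set.range ι))))) [Module ↥(padicCoeffIntegers (Set.range ι)) ↥Sg],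 (∀ (a : ↥(padicCoeffIntegers (Set.range ι))) (s : ↥Sg), ((a • s : ↥Sg) : subgroupH1 κ.kerSubgroup (Cofree ρ ↥(padicCoeffField (Set.range ι)))) = scalarH1 κ.kerSubgroup (Cofree ρ ↥(padicCoeffField (Set.range ι))) a s) → (∀ y : subgroupH1 κ.kerSubgroup (Cofree ρ ↥(padicCoeffField (Set.range ι))), y ∈ Sg ↔ y ∈ {y : subgroupH1 κ.kerSubgroup (Cofree ρ ↥(padicCoeffField (Set.range ι))) | y ∈ unramifiedOutside κ.kerSubgroup (Cofree ρ ↥(padicCoeffField (Set.range ι))) 2 ↑S₀ ∧ (∀ w σ, conjH1 κ.kerSubgroup (Cofree ρ ↥(padicCoeffField (Set.range ι))) σ y ∈ infKer κ.kerSubgroup (Cofree ρ ↥(padicCoeffField (Set.range ι))) w) ∧ (∀ v hv σ, ∃ (φ : _) (Q : Fin n → localPoints W (v.adicCompletion ℚ)) (k : ℕ), oneCocycleClass (discreteTopRep ↥κ.kerSubgroup (Cofree ρ ↥(padicCoeffField (Set.range ι)))) φ = conjH1 κ.kerSubgroup (Cofree ρ ↥(padicCoeffField (Set.range ι))) σ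 y ∧ (∀ i, (2 ^ k) • Q i ∈ ⨆ m : ℕ, signedLocalPoints κ (v.adicCompletion ℚ) W 1 m) ∧ ∀ τ i, pointsMapOfEmb W (closureEmb (K := ℚ) (v.adicCompletion ℚ)) (((Θ v hv (φ.1 (resGalSubgroupOfEmb κ.kerSubgroup (closureEmb (K := ℚ) (v.adicCompletion ℚ)) τ))) i : ↥(W.geomPrimaryTorsion 2)) : W.geomPoints) = (τ : absoluteGaloisGroup (v.adicCompletion ℚ)) • Q i - Q i)}) → (∀ (τ : absoluteGaloisGroup ℚ) (y : subgroupH1 κ.kerSubgroup (Cofree ρ ↥(padicCoeffField (Set.range ι)))), y ∈ Sg → conjH1 κ.kerSubgroup (Cofree ρ ↥(padicCoeffField (Set.range ι))) τ y ∈ Sg) → ({y : subgroupH1 κ.kerSubgroup (Cofree ρ ↥(padicCoeffField (Set.range ι))) | y ∈ unramifiedOutside κ.kerSubgroup (Cofree ρ ↥(padicCoeffField (Set.range ι))) 2 ↑S₀ ∧ (∀ w σ, conjH1 κ.kerSubgroup (Cofree ρ ↥(padicCoeffField (Set.range ι))) σ y ∈ infKer κ.kerSubgroup (Cofree ρ ↥(padicCoeffField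 (Set.range ι))) w) ∧ (∀ v hv σ, ∃ (φ : _) (Q : Fin n → localPoints W (v.adicCompletion ℚ)) (k : ℕ), oneCocycleClass (discreteTopRep ↥κ.kerSubgroup (Cofree ρ ↥(padicCoeffField (Set.range ι)))) φ = conjH1 κ.kerSubgroup (Cofree ρ ↥(padicCoeffField (Set.range ι))) σ y ∧ (∀ i, (2 ^ k) • Q i ∈ ⨆ m : ℕ, signedLocalPoints κ (v.adicCompletion ℚ) W 1 m) ∧ ∀ τ i, pointsMapOfEmb W (closureEmb (K := ℚ) (v.adicCompletion ℚ)) (((Θ v hv (φ.1 (resGalSubgroupOfEmb κ.kerSubgroup (closureEmb (K := ℚ) (v.adicCompletion ℚ)) τ))) i : ↥(W.geomPrimaryTorsion 2)) : W.geomPoints) = (τ : absoluteGaloisGroup (v.adicCompletion ℚ)) • Q i - Q i) ∧ scalarH1 κ.kerSubgroup (Cofree ρ ↥(padicCoeffField (Set.range ι))) ϖ y = 0} : Set _).Finite → ∀ (v : HeightOneSpectrum (RingOfIntegers ℚ)) (hv : ((2 : ℕ) : RingOfIntegers ℚ) ∈ v.asIdeal) (I : Kato2004.IwasawaH1DataCoeff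 (FramedGaloisRep.toGaloisRep ρ) 2 κ γ) [Module ↥(padicCoeffIntegers (Set.range ι)) I.H] [IsScalarTower ↥(padicCoeffIntegers (Set.range ι)) (IwasawaAlgebraO (Set.range ι)) I.H], (∀ (a : ↥(padicCoeffIntegers (Set.range ι))) (x : I.H), a • x = (PowerSeries.C a : IwasawaAlgebraO (Set.range ι)) • x) → ∀ (t₀ : ↥(padicCoeffIntegers (Set.range ι)) →+ ℤ_[2]), (∀ (c : ℤ_[2]) (a : ↥(padicCoeffIntegers (Set.range ι))), t₀ (padicIntToCoeffIntegers (Set.range ι) c * a) = c * t₀ a) → ∀ (nb : ℕ) (bO bO' : Fin nb → ↥(padicCoeffIntegers (Set.range ι))), (∀ a : ↥(padicCoeffIntegers (Set.range ι)), a = ∑ i, padicIntToCoeffIntegers (Set.range ι) (t₀ (a * bO' i)) * bO i) → ∀ (ζ : ℕ → AlgebraicClosure ℚ), (∀ k, IsPrimitiveRoot (ζ k) (2 ^ k)) → (∀ k, ζ (k + 1) ^ 2 = ζ k) → ∀ (ePk : ∀ k : ℕ, ↥(AddSubgroup.torsionBy (Cofree ρ ↥(padicCoeffField (Set.range ι)))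 ((2 ^ k : ℕ) : ℤ)) → ↥(AddSubgroup.torsionBy (Cofree ρ ↥(padicCoeffField (Set.range ι))) ((2 ^ k : ℕ) : ℤ)) → AlgebraicClosure ℚ) (hμPk : ∀ k a b, ePk k a b ^ (2 ^ k) = 1) (hadd₁Pk : ∀ k a₁ a₂ b, ePk k (a₁ + a₂) b = ePk k a₁ b * ePk k a₂ b) (hadd₂Pk : ∀ k a b₁ b₂, ePk k a (b₁ + b₂) = ePk k a b₁ * ePk k a b₂) (hgalPk : ∀ k (σ : absoluteGaloisGroup ℚ) (a b : ↥(AddSubgroup.torsionBy (Cofree ρ ↥(padicCoeffField (Set.range ι))) ((2 ^ k : ℕ) : ℤ))), σ • ePk k a b = ePk k (cofreeTorsionGaloisModule (Set.range ι) ρ _ σ a) (cofreeTorsionGaloisModule (Set.range ι) ρ _ σ b)), (∀ k (s t : Fin 2 → ↥(padicCoeffIntegers (Set.range ι))), ePk k (divPowCofreeMkTorsion (Set.range ι) ρ k s) (divPowCofreeMkTorsion (Set.range ι) ρ k t) = ζ k ^ (PadicInt.toZModPow k (t₀ (s 0 * t 1 - s 1 * t 0))).val) → ∀ (pair : ∀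 m : ℕ, H1 (FramedGaloisRep.toGaloisRep ρ) (κ.layerSubgroup m) →+ ((Fin n → ↥(localLayerPointsOfEmb κ (closureEmb (K := ℚ) (v.adicCompletion ℚ)) W m)) →+ ℤ_[2])), (∀ (m k : ℕ) (x : H1 (FramedGaloisRep.toGaloisRep ρ) (κ.layerSubgroup m)) (Q : Fin n → ↥(localLayerPointsOfEmb κ (closureEmb (K := ℚ) (v.adicCompletion ℚ)) W m)), PadicInt.toZModPow k (pair m x Q) = CyclotomicLayer.rhoLayerPairingPk (Set.range ι) ρ W ePk hμPk hadd₁Pk hadd₂Pk hgalPk (Θ v hv) κ v (hΘ v hv) m k x Q) → ∀ (locd₂ : I.H →+ ((Fin n → ↥(Sprung2012.localTowerPointsOfEmb κ (closureEmb (K := ℚ) (v.adicCompletion ℚ)) W)) →+ ℤ_[2])), (∀ (m : ℕ) (x : I.H) (Q : Fin n → localPoints W (v.adicCompletion ℚ)) (hQ : ∀ i, Q i ∈ localLayerPointsOfEmb κ (closureEmb (K := ℚ) (v.adicCompletion ℚ)) W m), locd₂ x (fun i => ⟨Q i, Sprung2012.localLayerPointsOfEmb_le_localTowerPointsOfEmb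 κ (closureEmb (K := ℚ) (v.adicCompletion ℚ)) W m (hQ i)⟩) = pair m (I.proj m x) (fun i => ⟨Q i, hQ i⟩)) → ∀ (col : (↥(Sprung2012.localTowerPointsOfEmb κ (closureEmb (K := ℚ) (v.adicCompletion ℚ)) W) →+ ℤ_[2]) →ₗ[ℤ_[2]] PowerSeries ℤ_[2]), (∃ (gH : absoluteGaloisGroup (v.adicCompletion ℚ)) (dH : ℕ → localPoints W (v.adicCompletion ℚ)) (hdA : ∀ m j, gH ^ j • dH m ∈ Sprung2012.localTowerPointsOfEmb κ (closureEmb (K := ℚ) (v.adicCompletion ℚ)) W), κ.IsTopGenerator (resGalOfEmb (closureEmb (K := ℚ) (v.adicCompletion ℚ)) gH) ∧ (∀ m, dH m ∈ localLayerPointsOfEmb κ (closureEmb (K := ℚ) (v.adicCompletion ℚ)) W m) ∧ (∀ m, localTraceOfEmb κ (closureEmb (K := ℚ) (v.adicCompletion ℚ)) W (m + 1) (m + 2) (dH (m + 2)) = -dH m) ∧ (∀ b ∈ localLayerPointsOfEmb κ (closureEmb (K := ℚ) (v.adicCompletion ℚ)) W 0, dH 0 ≠ 2 • b) ∧ (∀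 (z : ↥(Sprung2012.localTowerPointsOfEmb κ (closureEmb (K := ℚ) (v.adicCompletion ℚ)) W) →+ ℤ_[2]) (m : ℕ), (((cyclotomicOmega 2 (2 * m)).map (Int.castRingHom ℤ_[2]) : Polynomial ℤ_[2]) : PowerSeries ℤ_[2]) ∣ ((∑ j ∈ Finset.range (2 ^ (2 * m)), Polynomial.C (z ⟨gH ^ j • dH (2 * m), hdA (2 * m) j⟩) * (Polynomial.X + 1) ^ j : Polynomial ℤ_[2]) : PowerSeries ℤ_[2]) + (-1 : PowerSeries ℤ_[2]) ^ m * (((cyclotomicOmegaMinus 2 (2 * m)).map (Int.castRingHom ℤ_[2]) : Polynomial ℤ_[2]) : PowerSeries ℤ_[2]) * col z) ∧ (∀ (z : ↥(Sprung2012.localTowerPointsOfEmb κ (closureEmb (K := ℚ) (v.adicCompletion ℚ)) W) →+ ℤ_[2]) (Lz : PowerSeries ℤ_[2]), (∀ m : ℕ, (((cyclotomicOmega 2 (2 * m)).map (Int.castRingHom ℤ_[2]) : Polynomial ℤ_[2]) : PowerSeries ℤ_[2]) ∣ ((∑ j ∈ Finset.range (2 ^ (2 * m)), Polynomial.C (z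 ⟨gH ^ j • dH (2 * m), hdA (2 * m) j⟩) * (Polynomial.X + 1) ^ j : Polynomial ℤ_[2]) : PowerSeries ℤ_[2]) + (-1 : PowerSeries ℤ_[2]) ^ m * (((cyclotomicOmegaMinus 2 (2 * m)).map (Int.castRingHom ℤ_[2]) : Polynomial ℤ_[2]) : PowerSeries ℤ_[2]) * Lz) → Lz = col z)) → Function.Surjective col → (∀ z : ↥(Sprung2012.localTowerPointsOfEmb κ (closureEmb (K := ℚ) (v.adicCompletion ℚ)) W) →+ ℤ_[2], col z = 0 ↔ ∀ (m : ℕ) (x : localPoints W (v.adicCompletion ℚ)) (hx : x ∈ signedLocalPoints κ (v.adicCompletion ℚ) W 1 m), z ⟨x, Sprung2012.localLayerPointsOfEmb_le_localTowerPointsOfEmb κ (closureEmb (K := ℚ) (v.adicCompletion ℚ)) W m (signedLocalPointsOfEmb_le κ (closureEmb (K := ℚ) (v.adicCompletion ℚ)) W 1 m hx)⟩ = 0) → ∀ (f : ℕ) (B : (Fin f → ℤ_[2]) ≃+ ↥(padicCoeffIntegers (Set.range ι))), (∀ (c : ℤ_[2]) (y : Fin f → ℤ_[2]), B (c • y) =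 padicIntToCoeffIntegers (Set.range ι) c * B y) → ∀ (Sel₀ : Submodule ↥(padicCoeffIntegers (Set.range ι)) ↥Sg), (∀ s : ↥Sg, s ∈ Sel₀ ↔ (∀ (v' : HeightOneSpectrum (RingOfIntegers ℚ)) (hv' : ((2 : ℕ) : RingOfIntegers ℚ) ∈ v'.asIdeal) (σ : absoluteGaloisGroup ℚ), ∃ (φ : contOneCocycles (discreteTopRep ↥κ.kerSubgroup (Cofree ρ ↥(padicCoeffField (Set.range ι))))) (Q : Fin n → localPoints W (v'.adicCompletion ℚ)) (k : ℕ), oneCocycleClass (discreteTopRep ↥κ.kerSubgroup (Cofree ρ ↥(padicCoeffField (Set.range ι)))) φ = conjH1 κ.kerSubgroup (Cofree ρ ↥(padicCoeffField (Set.range ι))) σ (s : subgroupH1 κ.kerSubgroup (Cofree ρ ↥(padicCoeffField (Set.range ι)))) ∧ (∀ i, (2 ^ k) • Q i ∈ (⊥ : AddSubgroup (localPoints W (v'.adicCompletion ℚ)))) ∧ ∀ (τ : ↥(localSubgroupOfEmb κ.kerSubgroup (closureEmb (K := ℚ) (v'.adicCompletion ℚ)))) (i : Fin n), pointsMapOfEmb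 W (closureEmb (K := ℚ) (v'.adicCompletion ℚ)) ((Θ v' hv' (φ.1 (resGalSubgroupOfEmb κ.kerSubgroup (closureEmb (K := ℚ) (v'.adicCompletion ℚ)) τ)) i : ↥(W.geomPrimaryTorsion 2)) : W.geomPoints) = (τ : absoluteGaloisGroup (v'.adicCompletion ℚ)) • Q i - Q i) ∧ (∀ w ∈ S₀, ∀ σ : absoluteGaloisGroup ℚ, conjH1 κ.kerSubgroup (Cofree ρ ↥(padicCoeffField (Set.range ι))) σ (s : subgroupH1 κ.kerSubgroup (Cofree ρ ↥(padicCoeffField (Set.range ι)))) ∈ unramifiedKer κ.kerSubgroup (Cofree ρ ↥(padicCoeffField (Set.range ι))) w)) → ∀ (z : I.H) (D : IwasawaAlgebraO (Set.range ι)), D ≠ 0 → Module.Finite ℚ_[2] (TensorProduct ℤ_[2] ℚ_[2] ((Fin n → PowerSeries ℤ_[2]) ⧸ Submodule.span (PowerSeries ℤ_[2]) ((fun x : I.H => fun i : Fin n => col ((locd₂ x).comp (AddMonoidHom.single (fun _ : Fin n => ↥(Sprung2012.localTowerPointsOfEmb κ (closureEmb (K := ℚ) (v.adicCompletion ℚ))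 W)) i))) '' (↑(Submodule.span (IwasawaAlgebraO (Set.range ι)) ({z} : Set I.H)) : Set I.H)))) → f * (d + Module.finrank (FractionRing ↥(padicCoeffIntegers (Set.range ι))) (TensorProduct ↥(padicCoeffIntegers (Set.range ι)) (FractionRing ↥(padicCoeffIntegers (Set.range ι))) (IwasawaAlgebraO (Set.range ι) ⧸ Ideal.span {D}))) ≤ Module.finrank ℚ_[2] (TensorProduct ℤ_[2] ℚ_[2] ((Fin n → PowerSeries ℤ_[2]) ⧸ Submodule.span (PowerSeries ℤ_[2]) ((fun x : I.H => fun i : Fin n => col ((locd₂ x).comp (AddMonoidHom.single (fun _ : Fin n => ↥(Sprung2012.localTowerPointsOfEmb κ (closureEmb (K := ℚ) (v.adicCompletion ℚ)) W)) i))) '' (↑(Submodule.span (IwasawaAlgebraO (Set.range ι)) ({z} : Set I.H)) : Set I.H)))) → Module.Finite (FractionRing ↥(padicCoeffIntegers (Set.range ι))) (TensorProduct ↥(padicCoeffIntegers (Set.range ι)) (FractionRing ↥(padicCoeffIntegers (Set.range ι))) (I.H ⧸ Submodule.span (IwasawaAlgebraO (Set.range ι)) ({z} : Set I.H))) → Module.finrank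 (FractionRing ↥(padicCoeffIntegers (Set.range ι))) (TensorProduct ↥(padicCoeffIntegers (Set.range ι)) (FractionRing ↥(padicCoeffIntegers (Set.range ι))) (I.H ⧸ Submodule.span (IwasawaAlgebraO (Set.range ι)) ({z} : Set I.H))) ≤ Module.finrank (FractionRing ↥(padicCoeffIntegers (Set.range ι))) (TensorProduct ↥(padicCoeffIntegers (Set.range ι)) (FractionRing ↥(padicCoeffIntegers (Set.range ι))) (CharacterModule ↥Sel₀)) + Module.finrank (FractionRing ↥(padicCoeffIntegers (Set.range ι))) (TensorProduct ↥(padicCoeffIntegers (Set.range ι)) (FractionRing ↥(padicCoeffIntegers (Set.range ι))) (IwasawaAlgebraO (Set.range ι) ⧸ Ideal.span {D})) → ∃ (P : Type) (_ : AddCommGroup P) (_ : Module ℤ_[2] P) (H : Type) (_ : AddCommGroup H) (_ : Module ↥(padicCoeffIntegers (Set.range ι)) H) (H2 : Type) (_ : AddCommGroup H2) (_ : Module ↥(padicCoeffIntegers (Set.range ι)) H2) (pair : P →+ CharacterModule ↥Sg) (locd : H →+ P) (Z : Submodule ↥(padicCoeffIntegers (Set.range ι)) H) (Sel₀ : Submodule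 ↥(padicCoeffIntegers (Set.range ι)) ↥Sg) (e f : ℕ) (B : (Fin f → ℤ_[2]) ≃+ ↥(padicCoeffIntegers (Set.range ι))), (∀ (z : ℤ_[2]) (c : Fin f → ℤ_[2]), B (z • c) = padicIntToCoeffIntegers (Set.range ι) z * B c) ∧ (∀ (z : ℤ_[2]) (t : P) (s : ↥Sg), pair (z • t) s = pair t (padicIntToCoeffIntegers (Set.range ι) z • s)) ∧ (∀ (z : ℤ_[2]) (x : H), locd (padicIntToCoeffIntegers (Set.range ι) z • x) = z • locd x) ∧ (∀ x ∈ Z, pair (locd x) = 0) ∧ (∀ s ∈ Sel₀, ∀ t : P, pair t s = 0) ∧ (∀ t : P, pair t = 0 → ∃ a : ℤ_[2], a ≠ 0 ∧ ∃ x : H, a • t = locd x) ∧ Module.Finite (FractionRing ↥(padicCoeffIntegers (Set.range ι))) (TensorProduct ↥(padicCoeffIntegers (Set.range ι)) (FractionRing ↥(padicCoeffIntegers (Set.range ι))) (H ⧸ Z)) ∧ Module.Finite ℚ_[2] (TensorProduct ℤ_[2] ℚ_[2] (P ⧸ Submodule.span ℤ_[2] (locd '' (Z : Set H)))) ∧ f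 * (d + (∑ v ∈ S₀, 2 ^ padicValNat 2 ((natGenerator v ^ 2 - 1) / 8) * (if natGenerator v ∣ M then (if ‖embCoeff g ι (natGenerator v) - 1‖ < 1 then 1 else 0) else (if ‖embCoeff g ι (natGenerator v)‖ < 1 then 2 else 0))) + e) ≤ Module.finrank ℚ_[2] (TensorProduct ℤ_[2] ℚ_[2] (P ⧸ Submodule.span ℤ_[2] (locd '' (Z : Set H)))) ∧ Module.finrank (FractionRing ↥(padicCoeffIntegers (Set.range ι))) (TensorProduct ↥(padicCoeffIntegers (Set.range ι)) (FractionRing ↥(padicCoeffIntegers (Set.range ι))) (H ⧸ Z)) ≤ Module.finrank (FractionRing ↥(padicCoeffIntegers (Set.range ι))) (TensorProduct ↥(padicCoeffIntegers (Set.range ι)) (FractionRing ↥(padicCoeffIntegers (Set.range ι))) H2) + e ∧ Module.finrank (FractionRing ↥(padicCoeffIntegers (Set.range ι))) (TensorProduct ↥(padicCoeffIntegers (Set.range ι)) (FractionRing ↥(padicCoeffIntegers (Set.range ι))) H2) ≤ Module.finrank (FractionRing ↥(padicCoeffIntegers (Set.range ι))) (TensorProduct ↥(padicCoeffIntegers (Set.range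 ι)) (FractionRing ↥(padicCoeffIntegers (Set.range ι))) (CharacterModule ↥Sel₀)) := by
  intro hLV h1 hEH h42 h40 h2 W _ _ hCM hr0 hss ha2 hΔ M _ g ι Ω hM hnew hcmf ha2g hΩ hcong κ γ hκ hγ hcyc S₀ hS₀ hbad hMS Lp Lm d hpol hle hlt
    n ρ Θ hρ hΘ ϖ hϖ Sg _ hsmul hmem hconj hfin v hv I _ _ hIH t₀ ht₀ nb bO bO' hbO ζ hζ hζ2 ePk hμPk hadd₁Pk hadd₂Pk hgalPk hePk pr hpr locd₂ hlocd₂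
    col hcol hsurj hker f B hB Sel₀ hSel₀ z D hD hnz hiD hiifin hiiD
  -- the pin bundle (every field IS the corresponding binder, definitionally)
  let π : OnePairPins (Set.range ι) W κ γ S₀ n ρ Θ hΘ I Sg :=
    { v := v, hv := hv, t₀ := t₀, ht₀ := ht₀, nb := nb, bO := bO, bO' := bO', hbO := hbO, ζ := ζ, hζ := hζ, ePk := ePk, hμPk := hμPk,
      hadd₁Pk := hadd₁Pk, hadd₂Pk := hadd₂Pk, hgalPk := hgalPk, hePk := hePk, pair := pr, hpair := hpr, locd₂ := locd₂, hlocd₂ := hlocd₂,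
      col := col, hcol := hcol, hcol_surj := hsurj, hcol_ker := hker, f := f, B := B, hB := hB, Sel₀ := Sel₀, hSel₀ := hSel₀ }
  have hζ2π : ∀ k : ℕ, π.ζ (k + 1) ^ 2 = π.ζ k := hζ2
  -- S2 at the pins
  obtain ⟨pair₂, hsm, hVAL, hKER⟩ := h2 W hCM hr0 hss ha2 hΔ M g ι Ω hM hnew hcmf ha2g hΩ hcong κ γ hκ hγ hcyc S₀ hS₀ hbad hMS Lp Lm d hpol hle
    hlt n ρ Θ hρ hΘ ϖ hϖ Sg hsmul hmem hconj hfin v hv I hIH t₀ ht₀ nb bO bO' hbO ζ hζ ePk hμPk hadd₁Pk hadd₂Pk hgalPk hePk pr hpr locd₂ hlocd₂ col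
    hcol hsurj hker f B hB Sel₀ hSel₀
  -- T1: the AtTwo package
  obtain ⟨inst₂, π₂, hperf, Eplus, hSg, hπker⟩ :=
    AtTwoPackage.exists_atTwoPins_perfect (Set.range ι) W κ γ S₀ n ρ Θ hΘ I Sg hss hκ hmem π
  letI : Module ℤ_[2] (Dloc (Set.range ι) κ ρ π.v) := inst₂
  -- T2: the binder `ℤ₂`-structures on the `D_w` are the functorial ones; the Away package
  letI : ∀ w : ↥S₀, Module ℤ_[2] (Dloc (Set.range ι) κ ρ (w : HeightOneSpectrum (𝓞 ℚ))) := fun w ↦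
    dlocModule (Set.range ι) κ ρ (w : HeightOneSpectrum (𝓞 ℚ))
  obtain ⟨πₐ⟩ := exists_awayPins π hκ hS₀ hζ2π fun w a y ↦ dlocModule_smul_def (Set.range ι) κ ρ (w : HeightOneSpectrum (𝓞 ℚ)) a y
  -- S1⊕ at (π, πₐ): finiteness of `P_{S₀}` and the away count, transported to the supply exponent `Σ_g(S₀)` (LVsq)
  obtain ⟨hfinA, hSaway⟩ := h1 W hss ha2 hΔ M g ι hM hnew hcmf ha2g hcong κ γ hκ hγ hcyc S₀ hS₀ hbad hMS n ρ Θ hρ hΘ ϖ hϖ Sg hsmul hmem hconj hfin I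
    hIH π πₐ
  have hS := mul_sigma_supply_le_of_away ι hLV S₀ hnew hcmf hSaway
  -- C7: finiteness and count of the product quotient
  haveI : Module.Finite ℚ_[2] (ℚ_[2] ⊗[ℤ_[2]] π.colocdQuot z) := hnz
  haveI : Module.Finite ℚ_[2] (ℚ_[2] ⊗[ℤ_[2]] PAway (Set.range ι) κ ρ S₀) := hfinA
  have hQ : π.f * (d + lamO (Set.range ι) (IwasawaAlgebraO (Set.range ι) ⧸ Ideal.span {D})) ≤ lamTwo 2 (π.colocdQuot z) := hiD
  obtain ⟨hfinP, hcount⟩ := π.finite_and_count_span_locd_pins πₐ hγ z (supplyLocd π πₐ) (fun _ ↦ rfl) hQ hS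
  -- C6: the zeta quotient
  obtain ⟨hfinH, hii, -⟩ := π.supplyZeta_of_pins z hiifin hiiD
  -- C8
  exact onePairSupply_of_packages hss hκ hIH π π₂ hperf Eplus hSg hπker πₐ pair₂ hsm hVAL hKER
    (hEH W hss ha2 hΔ M g ι hM hnew hcmf ha2g hcong κ γ hκ hγ hcyc S₀ hS₀ hbad hMS n ρ Θ hρ hΘ ϖ hϖ Sg hsmul hmem hconj hfin I hIH π hζ2π π₂ πₐ)
    (h42 W hss ha2 hΔ M g ι hM hnew hcmf ha2g hcong κ γ hκ hγ hcyc S₀ hS₀ hbad hMS n ρ Θ hρ hΘ ϖ hϖ Sg hsmul hmem hconj hfin I hIH π hζ2π π₂ πₐ)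
    (h40 W hss ha2 hΔ M g ι hM hnew hcmf ha2g hcong κ γ hκ hγ hcyc S₀ hS₀ hbad hMS n ρ Θ hρ hΘ ϖ hϖ Sg hsmul hmem hconj hfin I hIH π hζ2π πₐ)
    (fun s hs t χ ↦ π.c₂_add_sum_locAway_eq_zero_of_mem_Sel₀ π₂ hκ hS₀ s hs t χ)
    (fun a χ s ↦ π.sum_smul_locAway hsmul πₐ a χ s)
    z d (lamO (Set.range ι) (IwasawaAlgebraO (Set.range ι) ⧸ Ideal.span {D})) _ hfinH hfinP hcount hii

end Summit.BirchSwinnertonDyer.BirchSwinnertonDyer.Theorems.OnePair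

end
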